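import Literature.MathematicalPhysics.QuantumFieldTheory.BalabanImbrieJaffe1984to88.BIJ88Ineq593Proof

/-!
# `BalabanImbrieJaffe1984to88.BIJ88Ineq595Proof` — T. Bałaban, J. Imbrie, A. Jaffe, *Effective action and cluster
properties of the abelian Higgs model*, Commun. Math. Phys. **114** (1988) 257–315 [BalabanImbrieJaffe1988]:
**(5.9.5)** p. 297 PROVED from its printed inputs — *"We want a similar bound for φ^{(k)}(x), x ∈ Λ₇^{(k)}. Note that
C^{(k)}_{loc}(u_{k+1}) is almost equal to C^{(k)}(u_{k+1}). Thus we have that in Λ₇^{(k)}, say, aL^{−2}C^{(k)}_{loc}(u_{k+1})Q(u_{k+1})*ψ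
= Q(u_{k+1})*ψ + O(p(e_k)), (the corresponding statement with C^{(k)}(u_{k+1}) was proven in [8, Eq. (2.113)]. Using arguments like
the ones we used to bound D_{ū_{k+1}}ψ, we can replace Q(u_{k+1})*ψ with φ in this bound. This proves that |φ^{(k)}(x)| ≤ cp(e_k),
x ∈ Λ₇^{(k)*}. (5.9.5)"*, where **(5.8.1)** p. 295: *"To eliminate most of the linear term ⟨ψ, Q(ũ_{k+1})φ⟩ in the small field region,
we make a translation φ = φ^{(k)} + aL^{−2}Λ₇^{(k)}C^{(k)}_{loc}(u_{k+1})Q*(u_{k+1})ψ. (5.8.1)"* — on the CONCRETE contour carrier of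
`BIJ88Sect3Statements` with the covariant block average `BIJ88Sect5StatementsPart4.covAvg` and the covariant telescoping lemmas of
`BIJ88Ineq593Proof` (kind «model-instance» for the typed leaf `BIJ88Sect5StatementsPart2.Ineq595`).

statement-level skeleton of published theorems with citation tags; proofs where landed; nothing here is a claim about the Yang–Mills mass gap

PDF held: `paper:balaban1988-cmp114-bij-abelian-higgs-effective-action` (journal page = PDF page + 256).  Pages read as images:
PDF pp. 39–41 (journal 295–297), `g4png.py` ×2 renders (seat folder `renders/original-p039-x2.png`; `HOME/lit-balaban-r16/renders/
cmp114/original-p040-x2.png`, `-p041-x2.png`).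

CITATION HEADER (lean-in-tree rule).  Part of the lit-balaban TYPED SKELETON (HOME `run/shared/lean/pub/lit-balaban/`), Phase 2,
seat p36 (gen 3, unit `lit-balaban-p36`); row **C2.Eq5.9.4-5.9.5**, display (5.9.5), of `HOME/lit-balaban-r16/ROWS-C2-part2.md`
(leaf typed p240155 by r16).  WHAT IS REPRODUCED, and how (theorem-only; `u` a unimodular ℂ-valued bond field on `T_η`, block field
`ψ` on coarse sites `κ` with blocks `B(y) ⊂ T_η`, `|B(y)|·w = 1`, block label `blk x` of a fine site, contours `Γ_{y,x}` of [2] as DATA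
with their `IsPath` clauses and lengths `≤ n_Γ`):
* `Q(u)^*` = the blockwise ADJOINT of `(Q(u)φ)(y) = Σ_{x∈B(y)} w·u(Γ_{y,x})φ(x)`: `(Q(u)^*ψ)(x) = conj(u(Γ_{y,x}))ψ(y)`, `y = blk x`
  (fine-lattice weights `η^d = w·(Lη)^d` absorbed as printed) — adjointness `conj_mul_covAvg`, and `Q(u)Q(u)^* = I` (`covAvg_qstar`).
* THE [8, (2.113)] INPUT, i.e. the unnumbered display *"in Λ₇^{(k)}: aL^{−2}C^{(k)}_{loc}(u)Q(u)^*ψ = Q(u)^*ψ + O(p(e_k))"*, enters as the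
  displayed hypothesis `h2113 : ‖(Tψ)(x) − (Q(u)^*ψ)(x)‖ ≤ c₃p(e_k)` on the region, `T = aL^{−2}C^{(k)}_{loc}(u)Q(u)^*` an abstract map
  (a DEPGRAPH edge to [8] = B2, as the leaf's docstring says — not re-proved here); `Λ₇^{(k)}` = the multiplier `χ₇`, `= 1` on the region.
* THE PRINTED STEP *"Using arguments like the ones we used to bound D_ūψ, we can replace Q(u)^*ψ with φ"* PROVED:
  `‖(Q(u)^*ψ)(x) − φ(x)‖ = ‖ψ(y) − u(Γ_{y,x})φ(x)‖ ≤ ‖ψ(y) − (Q(u)φ)(y)‖ + ‖(Q(u)φ)(y) − u(Γ_{y,x})φ(x)‖` and the second term is an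
  average of transports along the paths `x → base(y) → x′`, `x′ ∈ B(y)` (`norm_covAvg_sub_transport_le`, via
  `BIJ88Ineq593Proof.norm_pair_le` with the empty line), each `≤ Σ_{b∈path}‖D_uφ(b)‖ ≤ 2n_Γc₂p(e_k)`: `norm_qstar_sub_le`.
* Hence **`ineq595 : Ineq595 T_η inRegion (φ − χ₇·Tψ) (c₁ + 2n_Γc₂ + c₃) p(e_k)`** for `φ^{(k)} = φ − Λ₇aL^{−2}C_{loc}Q^*ψ` of (5.8.1),
  from the restrictions `|ψ − Q(u)φ| ≤ c₁p(e_k)` ((5.2.2), at the block of `x`) and `|D_uφ| ≤ c₂p(e_k)` (on the paths' bonds); the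
  constant explicit.
NOT here (prose in print, not claimed): as in `BIJ88Ineq593Proof`, the same `u` is used in `Q(u)`, `Q(u)^*` and the restrictions
(the passage `ũ_{k+1}/u_k → u_{k+1}`, pp. 296–297, is not formalized); [8, (2.113)] itself; no new `Prop` facts; axioms standard.
-/

namespace Literature.MathematicalPhysics.QuantumFieldTheory.BalabanImbrieJaffe1984to88.BIJ88Ineq595Proof

open Literature.MathematicalPhysics.QuantumFieldTheory.Balaban1983to89
open BIJ88Sect3Statements BIJ88Sect5StatementsPart2 BIJ88Sect5StatementsPart4 BIJ88Ineq593Proof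
open Complex

variable {P : Params} {j : ℕ}

/-! ## §1 `Q(u)^*`: the blockwise adjoint, `Q Q^* = I`, (5.8.1) -/

section Blocks

variable {κ : Type*}

/-- the blockwise ADJOINT identity behind `Q*(u)` of (5.8.1): `conj(ψ(y))·(Q(u)φ)(y) = Σ_{x∈B(y)} w·conj(conj(u(Γ_{y,x}))ψ(y))·φ(x)`,
i.e. `⟨ψ, Q(u)φ⟩ = ⟨Q(u)^*ψ, φ⟩` block by block with `(Q(u)^*ψ)(x) = conj(u(Γ_{y,x}))ψ(y)`, `x ∈ B(y)`.
[cite: BalabanImbrieJaffe1988, (5.8.1) p.295] -/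
theorem conj_mul_covAvg (B : κ → Finset (Balaban1983to89.Site P j)) (w : ℝ) (U : κ → Balaban1983to89.Site P j → ℂ)
    (φ : Balaban1983to89.Site P j → ℂ) (ψ : κ → ℂ) (y : κ) :
    (starRingEnd ℂ) (ψ y) * covAvg B w U φ y =
      ∑ x ∈ B y, (w : ℂ) * (starRingEnd ℂ) ((starRingEnd ℂ) (U y x) * ψ y) * φ x := by
  unfold covAvg
  rw [Finset.mul_sum]
  refine Finset.sum_congr rfl fun x _ => ?_
  rw [map_mul, Complex.conj_conj]
  ring

/-- `Q(u)Q(u)^* = I`: `(Q(u)(Q(u)^*ψ))(y) = ψ(y)` for unimodular transporters, `|B(y)|·w = 1`, and `blk x = y` on `B(y)`.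
[cite: BalabanImbrieJaffe1988, (5.8.1) p.295] -/
theorem covAvg_qstar (B : κ → Finset (Balaban1983to89.Site P j)) (w : ℝ) (U : κ → Balaban1983to89.Site P j → ℂ)
    (hU : ∀ y x, ‖U y x‖ = 1) (blk : Balaban1983to89.Site P j → κ) (ψ : κ → ℂ) {y : κ}
    (hBy : ((B y).card : ℝ) * w = 1) (hblk : ∀ x ∈ B y, blk x = y) :
    covAvg B w U (fun x => (starRingEnd ℂ) (U (blk x) x) * ψ (blk x)) y = ψ y := by
  have hBy' : ((B y).card : ℂ) * (w : ℂ) = 1 := by exact_mod_cast hBy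
  unfold covAvg
  calc ∑ x ∈ B y, (w : ℂ) * U y x * ((starRingEnd ℂ) (U (blk x) x) * ψ (blk x))
      = ∑ x ∈ B y, (w : ℂ) * ψ y := by
        refine Finset.sum_congr rfl fun x hx => ?_
        rw [hblk x hx]
        have hmc : U y x * (starRingEnd ℂ) (U y x) = 1 := by
          rw [Complex.mul_conj, Complex.normSq_eq_norm_sq, hU y x]; simp
        calc (w : ℂ) * U y x * ((starRingEnd ℂ) (U y x) * ψ y) = (w : ℂ) * (U y x * (starRingEnd ℂ) (U y x)) * ψ y := by ring
          _ = (w : ℂ) * ψ y := by rw [hmc, mul_one]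
    _ = ψ y := by rw [Finset.sum_const, nsmul_eq_mul, ← mul_assoc, hBy', one_mul]

/-- **(5.8.1)** p. 295, *"φ = φ^{(k)} + aL^{−2}Λ₇^{(k)}C^{(k)}_{loc}(u_{k+1})Q*(u_{k+1})ψ"*: with `T = aL^{−2}C^{(k)}_{loc}Q^*` and `Λ₇` the
multiplier `χ₇`, `φ^{(k)} := φ − χ₇·Tψ` is the translated field. [cite: BalabanImbrieJaffe1988, (5.8.1) p.295] -/
theorem eq581 (φ : Balaban1983to89.Site P j → ℂ) (χ₇ : Balaban1983to89.Site P j → ℂ) (T : (κ → ℂ) → Balaban1983to89.Site P j → ℂ)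
    (ψ : κ → ℂ) : φ = (fun x => φ x - χ₇ x * T ψ x) + fun x => χ₇ x * T ψ x := by
  funext x
  simp

/-! ## §2 "replace Q(u)^*ψ with φ": the telescoping step -/

/-- `(Q(u)φ)(y) − c = Σ_{x′∈B(y)} w·(u(Γ_{y,x′})φ(x′) − c)` for `|B(y)|·w = 1`. [cite: BalabanImbrieJaffe1988, (5.9.5) p.297] -/
theorem covAvg_sub_const (B : κ → Finset (Balaban1983to89.Site P j)) (w : ℝ) (U : κ → Balaban1983to89.Site P j → ℂ)
    (φ : Balaban1983to89.Site P j → ℂ) {y : κ} (hBy : ((B y).card : ℝ) * w = 1) (c : ℂ) :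
    covAvg B w U φ y - c = ∑ x' ∈ B y, (w : ℂ) * (U y x' * φ x' - c) := by
  have hBy' : ((B y).card : ℂ) * (w : ℂ) = 1 := by exact_mod_cast hBy
  have hc : c = ∑ _x' ∈ B y, (w : ℂ) * c := by
    rw [Finset.sum_const, nsmul_eq_mul, ← mul_assoc, hBy', one_mul]
  conv_lhs => rw [hc]
  unfold covAvg
  rw [← Finset.sum_sub_distrib]
  exact Finset.sum_congr rfl fun x _ => by ring

/-- *"Using arguments like the ones we used to bound D_ūψ"*, step 1 — the block average against one of its own terms:
`‖(Q(u)φ)(y) − u(Γ_{y,x})φ(x)‖ ≤ p₃` for `x ∈ B(y)`, when every telescoping sum `Σ‖D_uφ(b)‖` along the paths `x → base(y) → x′`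
(`Γ_{y,x}` reversed, then `Γ_{y,x′}`), `x′ ∈ B(y)`, is `≤ p₃`. [cite: BalabanImbrieJaffe1988, (5.9.5) p.297] -/
theorem norm_covAvg_sub_transport_le (u : PBond P j → ℂ) (hu : ∀ b, ‖u b‖ = 1) (φ : Balaban1983to89.Site P j → ℂ)
    (B : κ → Finset (Balaban1983to89.Site P j)) (w : ℝ) (hw : 0 ≤ w) (base : κ → Balaban1983to89.Site P j)
    (Γ : κ → Balaban1983to89.Site P j → Contour P j) {y : κ} (hBy : ((B y).card : ℝ) * w = 1)
    (hΓy : ∀ x ∈ B y, IsPath (base y) (Γ y x) x) {x : Balaban1983to89.Site P j} (hx : x ∈ B y) {p₃ : ℝ}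
    (hD : ∀ x' ∈ B y, ((((Γ y x).reverse.map fun s => (s.1, !s.2)) ++ Γ y x').map fun s => ‖covD 1 u φ s.1‖).sum ≤ p₃) :
    ‖covAvg B w (fun z x => transport u (Γ z x)) φ y - transport u (Γ y x) * φ x‖ ≤ p₃ := by
  rw [covAvg_sub_const B w _ φ hBy]
  calc ‖∑ x' ∈ B y, (w : ℂ) * (transport u (Γ y x') * φ x' - transport u (Γ y x) * φ x)‖
      ≤ ∑ x' ∈ B y, ‖(w : ℂ) * (transport u (Γ y x') * φ x' - transport u (Γ y x) * φ x)‖ := norm_sum_le _ _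
    _ ≤ ∑ _x' ∈ B y, w * p₃ := by
        refine Finset.sum_le_sum fun x' hx' => ?_
        rw [norm_mul, Complex.norm_real, Real.norm_of_nonneg hw]
        refine mul_le_mul_of_nonneg_left ?_ hw
        have hnil : IsPath (base y) ([] : Contour P j) (base y) := isPath_nil.mpr rfl
        have h := norm_pair_le u hu φ (hΓy x hx) hnil (hΓy x' hx')
        rw [transport_nil, one_mul, List.append_nil] at h
        exact h.trans (hD x' hx')
    _ = p₃ := by rw [Finset.sum_const, nsmul_eq_mul, ← mul_assoc, hBy, one_mul]

/-- step 2 — *"replace Q(u)^*ψ with φ"*: `‖(Q(u)^*ψ)(x) − φ(x)‖ = ‖ψ(y) − u(Γ_{y,x})φ(x)‖ ≤ ‖ψ(y) − (Q(u)φ)(y)‖ + ‖(Q(u)φ)(y) −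
u(Γ_{y,x})φ(x)‖ ≤ p₁ + p₃` (unimodularity; the restriction on `ψ − Q(u)φ`; step 1). [cite: BalabanImbrieJaffe1988, (5.9.5) p.297] -/
theorem norm_qstar_sub_le (u : PBond P j → ℂ) (hu : ∀ b, ‖u b‖ = 1) (φ : Balaban1983to89.Site P j → ℂ)
    (B : κ → Finset (Balaban1983to89.Site P j)) (w : ℝ) (hw : 0 ≤ w) (base : κ → Balaban1983to89.Site P j)
    (Γ : κ → Balaban1983to89.Site P j → Contour P j) (ψ : κ → ℂ) {y : κ} (hBy : ((B y).card : ℝ) * w = 1)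
    (hΓy : ∀ x ∈ B y, IsPath (base y) (Γ y x) x) {x : Balaban1983to89.Site P j} (hx : x ∈ B y) {p₁ p₃ : ℝ}
    (hψ : ‖ψ y - covAvg B w (fun z x => transport u (Γ z x)) φ y‖ ≤ p₁)
    (hD : ∀ x' ∈ B y, ((((Γ y x).reverse.map fun s => (s.1, !s.2)) ++ Γ y x').map fun s => ‖covD 1 u φ s.1‖).sum ≤ p₃) :
    ‖(starRingEnd ℂ) (transport u (Γ y x)) * ψ y - φ x‖ ≤ p₁ + p₃ := by
  set T : ℂ := transport u (Γ y x) with hT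
  have hT1 : ‖T‖ = 1 := norm_transport u hu (Γ y x)
  have hmc : (starRingEnd ℂ) T * T = 1 := by
    rw [mul_comm, Complex.mul_conj, Complex.normSq_eq_norm_sq, hT1]; simp
  have key : (starRingEnd ℂ) T * ψ y - φ x = (starRingEnd ℂ) T * (ψ y - T * φ x) := by
    rw [mul_sub, ← mul_assoc, hmc, one_mul]
  rw [key, norm_mul, Complex.norm_conj, hT1, one_mul]
  calc ‖ψ y - T * φ x‖
      ≤ ‖ψ y - covAvg B w (fun z x => transport u (Γ z x)) φ y‖ +
          ‖covAvg B w (fun z x => transport u (Γ z x)) φ y - T * φ x‖ := norm_sub_le_norm_sub_add_norm_sub _ _ _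
    _ ≤ p₁ + p₃ := add_le_add hψ (norm_covAvg_sub_transport_le u hu φ B w hw base Γ hBy hΓy hx hD)

end Blocks

/-! ## §3 (5.9.5) as `Ineq595` -/

section Main

variable {κ : Type}

/-- **(5.9.5)** p. 297: for the translated field `φ^{(k)} = φ − Λ₇aL^{−2}C^{(k)}_{loc}(u)Q(u)^*ψ` of (5.8.1) (`T = aL^{−2}C_{loc}(u)Q(u)^*`
abstract, `Λ₇ = χ₇ = 1` on the region), from (i) the [8, (2.113)]-input *"in Λ₇: aL^{−2}C_{loc}Q^*ψ = Q^*ψ + O(p(e_k))"*: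
`‖(Tψ)(x) − conj(u(Γ_{y,x}))ψ(y)‖ ≤ c₃p(e_k)`, (ii) the restriction `‖ψ(y) − (Q(u)φ)(y)‖ ≤ c₁p(e_k)` at the block `y = blk x`, (iii)
`‖D_uφ‖ ≤ c₂p(e_k)` on the bonds of the paths `x → base(y) → x′` (contours of length `≤ n_Γ`): `‖φ^{(k)}(x)‖ ≤ (c₁ + 2n_Γc₂ + c₃)p(e_k)`
on the region — `Ineq595` with the explicit constant. [cite: BalabanImbrieJaffe1988, (5.9.5) p.297] -/
theorem ineq595 (u : PBond P j → ℂ) (hu : ∀ b, ‖u b‖ = 1) (φ : Balaban1983to89.Site P j → ℂ)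
    (B : κ → Finset (Balaban1983to89.Site P j)) (w : ℝ) (hw : 0 ≤ w) (base : κ → Balaban1983to89.Site P j)
    (Γ : κ → Balaban1983to89.Site P j → Contour P j) (ψ : κ → ℂ) (blk : Balaban1983to89.Site P j → κ)
    (T : (κ → ℂ) → Balaban1983to89.Site P j → ℂ) (χ₇ : Balaban1983to89.Site P j → ℂ)
    (inRegion : Balaban1983to89.Site P j → Prop) {c₁ c₂ c₃ pek : ℝ} {nΓ : ℕ} (hpek : 0 ≤ pek) (hc₂ : 0 ≤ c₂)
    (hχ₇ : ∀ x, inRegion x → χ₇ x = 1) (hblk : ∀ x, inRegion x → x ∈ B (blk x))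
    (hB : ∀ x, inRegion x → ((B (blk x)).card : ℝ) * w = 1)
    (hΓ : ∀ z, ∀ x ∈ B z, IsPath (base z) (Γ z x) x) (hlenΓ : ∀ z, ∀ x ∈ B z, (Γ z x).length ≤ nΓ)
    (h2113 : ∀ x, inRegion x → ‖T ψ x - (starRingEnd ℂ) (transport u (Γ (blk x) x)) * ψ (blk x)‖ ≤ c₃ * pek)
    (hψ : ∀ x, inRegion x → ‖ψ (blk x) - covAvg B w (fun z x => transport u (Γ z x)) φ (blk x)‖ ≤ c₁ * pek)
    (hφ : ∀ x, inRegion x → ∀ x' ∈ B (blk x),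
      ∀ s ∈ ((Γ (blk x) x).reverse.map fun s => (s.1, !s.2)) ++ Γ (blk x) x', ‖covD 1 u φ s.1‖ ≤ c₂ * pek) :
    Ineq595 (Balaban1983to89.Site P j) inRegion (fun x => φ x - χ₇ x * T ψ x) (c₁ + 2 * nΓ * c₂ + c₃) pek := by
  intro x hx
  simp only
  rw [hχ₇ x hx, one_mul]
  have hq : ‖(starRingEnd ℂ) (transport u (Γ (blk x) x)) * ψ (blk x) - φ x‖ ≤ c₁ * pek + 2 * nΓ * (c₂ * pek) := by
    refine norm_qstar_sub_le u hu φ B w hw base Γ ψ (hB x hx) (hΓ (blk x)) (hblk x hx) (hψ x hx) fun x' hx' => ?_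
    set path := ((Γ (blk x) x).reverse.map fun s => (s.1, !s.2)) ++ Γ (blk x) x' with hpath
    have hlen : path.length ≤ 2 * nΓ := by
      rw [hpath, List.length_append, List.length_map, List.length_reverse]
      have h1 := hlenΓ (blk x) x (hblk x hx)
      have h2 := hlenΓ (blk x) x' hx'
      omega
    have hsum := List.sum_le_card_nsmul (path.map fun s => ‖covD 1 u φ s.1‖) (c₂ * pek) (by
      intro a ha
      obtain ⟨s, hs, rfl⟩ := List.mem_map.mp ha
      exact hφ x hx x' hx' s hs)
    rw [List.length_map, nsmul_eq_mul] at hsum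
    refine hsum.trans ?_
    have : (path.length : ℝ) ≤ (2 * nΓ : ℕ) := by exact_mod_cast hlen
    push_cast at this
    exact mul_le_mul_of_nonneg_right this (mul_nonneg hc₂ hpek)
  calc ‖φ x - T ψ x‖
      ≤ ‖φ x - (starRingEnd ℂ) (transport u (Γ (blk x) x)) * ψ (blk x)‖ +
          ‖(starRingEnd ℂ) (transport u (Γ (blk x) x)) * ψ (blk x) - T ψ x‖ := norm_sub_le_norm_sub_add_norm_sub _ _ _
    _ ≤ (c₁ * pek + 2 * nΓ * (c₂ * pek)) + c₃ * pek := by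
        refine add_le_add ?_ ?_
        · rw [norm_sub_rev]; exact hq
        · rw [norm_sub_rev]; exact h2113 x hx
    _ = (c₁ + 2 * nΓ * c₂ + c₃) * pek := by ring

end Main

end Literature.MathematicalPhysics.QuantumFieldTheory.BalabanImbrieJaffe1984to88.BIJ88Ineq595Proof
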